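import Mathlib
import HarnessLib
import Summits.AtomisticToContinuum.FouriersLaw.Theses.JunctionLocality
import Summits.AtomisticToContinuum.FouriersLaw.Theorems.JunctionLocalityConductanceLowerBoundStubKuboLinkAux4
import Summits.AtomisticToContinuum.FouriersLaw.Theorems.JunctionLocalityConductanceLowerBoundStubKuboLinkAux5
import Summits.AtomisticToContinuum.FouriersLaw.Theorems.OddSectorIrreversibilityOddDensityIsCorrectorStationarity
import Summits.AtomisticToContinuum.FouriersLaw.Theorems.JunctionLocalityConductanceLowerBoundStubRowSum
import Summits.AtomisticToContinuum.FouriersLaw.Theorems.VanishingNoiseTransferVanishingNoiseBoundFlipBondCurrents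
import Summits.AtomisticToContinuum.FouriersLaw.Theorems.BondHeatUncertaintyLinearResponseFTURNessFacts
import Summits.AtomisticToContinuum.FouriersLaw.Theorems.BondHeatUncertaintyLinearResponseFTURBondHeatVarianceContinuityHelper5

/-!
# Kubo link of line `ForecastSensitivitySketch`, helper VI: the MIXING-FREE Kubo link from a pointwise growth
bound on the contact derivatives of the forward field (stub `stub_kuboLink`, crux stmt-AtomisticToContinuum-11749;
the third conditional form)

For the pinned anharmonic chain `pinnedChain ω₂ lam β γ` (all parameters `> 0`), `T > 0`, along the crux's
unique weak steady-state family `μ` with response coefficient `D_L` at `T`, `L ≥ 2`, `k_b = p_b² − T`, and a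
classical forward field `g` of the left bath (`C² ∩ L²(μ_T)`, mean zero, `L_{T,T} g = −k_0`):

* `stub_kuboLink_of_contactGradientBoundAt` — **`D_L/(L−1) = γ(1 − (γ/T²)⟨g, k_0⟩_{μ_T})` GIVEN the pointwise
  growth bound `|∂_{p_b} g|, |∂²_{p_b} g| ≤ C₁ e^{ϑ₁H}` at the two contacts `b ∈ {0, L−1}` for some `0 < ϑ₁`,
  `2ϑ₁ < 1/T`** (an explicit hypothesis on `g`, NOT in the tree: the landed forward field is the Hörmander-smooth
  representative of `∫₀^∞ P_t k_0 dt` with `|g| ≲ e^{H/4T}` and no derivative bounds).  NO mixing input.  Proof: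
  the generator is affine in the bath temperatures, `L_{T+δ/2,T−δ/2} g = −k_0 + (γδ/2)(∂²_{p_0} g − ∂²_{p_{L−1}} g)`
  POINTWISE (`generator_temp_split`, route `OddSectorIrreversibility`); the weak stationarity of `μ_δ` extends to the smooth, exponentially bounded `g`
  (helper IV `pinnedChain_integral_generator_eq_zero_of_expGrowth`; `g` smooth and `|g| ≲ e^{H/4T}` everywhere by
  helper V), whence the EXACT identity `⟨k_0⟩_δ/δ = (γ/2)(⟨∂²_{p_0} g⟩_δ − ⟨∂²_{p_{L−1}} g⟩_δ)` for `0 < |δ| < T`;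
  the family is weakly continuous at `δ = 0` on continuous `e^{ϑ₁H}`-bounded observables
  (`ness_tendsto_integral_of_growth`, landed), so `⟨k_0⟩_δ/δ → (γ/2)(μ_T(∂²_{p_0} g) − μ_T(∂²_{p_{L−1}} g))
  = (γ/2T²)(⟨g,k_0⟩ − ⟨g,k_{L−1}⟩)` (two cutoff-free Gaussian integrations by parts, helper IV); energy balance
  `totalCurrent(μ_δ)/δ = (L−1)γ(1/2 − ⟨k_0⟩_δ/δ)` (`totalCurrent_eq_left`), uniqueness of limits along
  `𝓝[≠] 0`, and the row sum `stub_rowSum`.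
* `stub_kuboLink_of_contactGradientBound` — the same with the growth bound quantified over all parameters,
  `T > 0`, `L ≥ 2` and all classical left forward fields (one global statement `CG`) in front of the stub's
  signature VERBATIM: `CG → stub_kuboLink`.

So the stub holds outright as soon as EITHER route item `ResponseIdentity` (helper I), OR `δ`-uniform mixing near
equilibrium (helper III), OR the contact-gradient growth bound `CG` (this file) is proved.
References: Rey-Bellet 2003, Rem. 4.4; Kundu–Dhar–Narayan 2009; Bonetto–Lebowitz–Rey-Bellet 2000 §5.
-/

noncomputable section

open MeasureTheory Filter Topology Set ProbabilityTheory
open scoped ContDiff NNReal ENNReal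
open Literature.MathematicalPhysics.KineticTheory.HeatConduction
open Literature.MathematicalPhysics.KineticTheory Literature.Probability.Process OscillatorChain
open Summit.AtomisticToContinuum.FouriersLaw.Theorems
open Summit.AtomisticToContinuum.FouriersLaw.Theorems.OddSectorIrreversibility (generator_temp_split sum_bath_two)
open Summit.AtomisticToContinuum.FouriersLaw.Theorems.SubdiffusiveBondHeat
open Summit.AtomisticToContinuum.FouriersLaw.Theorems.SuperadditiveResistance.DeviceLiouville (kin kin_eq_sq)
open Summit.AtomisticToContinuum.FouriersLaw.Cruxes.SuperadditiveResistance.FloatingProbeBypassLaplacian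

namespace Summit.AtomisticToContinuum.FouriersLaw.Cruxes.ConductanceLowerBound.ForecastSensitivity

section NESS

/-- **The Kubo link from a contact-gradient growth bound at `(T, L, g)`** (stub `stub_kuboLink`, third
conditional form, NO mixing input). Along a weak steady-state family `μ` of the pinned anharmonic chain (all
parameters `> 0`) which is unique in the class `IsSteadyState`, with response coefficient `D_L` at `T > 0`,
`L ≥ 2`: every classical mean-zero `C² ∩ L²(μ_T)` left forward field `g` whose first and second `p_b`-derivatives
at the two contacts `b ∈ {0, L−1}` grow at most like `C₁ e^{ϑ₁H}` (`0 < ϑ₁`, `2ϑ₁ < 1/T`) satisfies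
`D_L/(L−1) = γ(1 − (γ/T²)⟨g, p_0² − T⟩_{μ_T})`.  Proof: `L_δ g = −k_0 + (γδ/2)(∂²_{p_0}g − ∂²_{p_{L−1}}g)`
pointwise; weak stationarity of `μ_δ` on `g` (helper IV); weak continuity of the family at `δ = 0`
(`ness_tendsto_integral_of_growth`); two Gaussian integrations by parts under `μ_T` (helper IV); energy
balance (`totalCurrent_eq_left`); uniqueness of limits along `𝓝[≠] 0`; row sum (`stub_rowSum`). -/
theorem stub_kuboLink_of_contactGradientBoundAt
    {ω₂ lam β γ : ℝ} (μ : (N : ℕ) → ℝ → ℝ → Measure (PhaseSpace N)) {T : ℝ} (D : ℕ → ℝ)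
    (hω : 0 < ω₂) (hl : 0 < lam) (hβ : 0 < β) (hγ : 0 < γ) (hT : 0 < T)
    (hU : ∀ (N : ℕ) (T_L T_R : ℝ), 0 < T_L → 0 < T_R → ∀ ρ ρ' : Measure (PhaseSpace N),
        (pinnedChain ω₂ lam β γ).IsSteadyState N T_L T_R ρ →
        (pinnedChain ω₂ lam β γ).IsSteadyState N T_L T_R ρ' → ρ = ρ')
    (hμ : ∀ (N : ℕ) (T_L T_R : ℝ), 0 < T_L → 0 < T_R →
        (pinnedChain ω₂ lam β γ).IsSteadyState N T_L T_R (μ N T_L T_R))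
    {L : ℕ} (hL2 : 2 ≤ L)
    (hD : Tendsto (fun δ : ℝ =>
        (pinnedChain ω₂ lam β γ).totalCurrent (μ L (T + δ / 2) (T - δ / 2)) / δ) (𝓝[≠] 0) (𝓝 (D L)))
    {g : PhaseSpace L → ℝ} (hC : ContDiff ℝ 2 g)
    (hgL2 : MemLp g 2 ((pinnedChain ω₂ lam β γ).gibbsMeasure L T))
    (hmean : ∫ x, g x ∂((pinnedChain ω₂ lam β γ).gibbsMeasure L T) = 0)
    (hpde : ∀ x, (pinnedChain ω₂ lam β γ).generator L T T g x = -(kin L 0 x - T))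
    {C₁ ϑ₁ : ℝ} (hϑ₁ : 0 < ϑ₁) (h2ϑ₁ : 2 * ϑ₁ < 1 / T)
    (hgrad : ∀ x,
      |partialP (⟨0, by omega⟩ : Fin L) g x| ≤ C₁ * Real.exp (ϑ₁ * (pinnedChain ω₂ lam β γ).hamiltonian L x) ∧
      |partialP (⟨L - 1, by omega⟩ : Fin L) g x| ≤
        C₁ * Real.exp (ϑ₁ * (pinnedChain ω₂ lam β γ).hamiltonian L x) ∧
      |partialP (⟨0, by omega⟩ : Fin L) (partialP (⟨0, by omega⟩ : Fin L) g) x| ≤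
        C₁ * Real.exp (ϑ₁ * (pinnedChain ω₂ lam β γ).hamiltonian L x) ∧
      |partialP (⟨L - 1, by omega⟩ : Fin L) (partialP (⟨L - 1, by omega⟩ : Fin L) g) x| ≤
        C₁ * Real.exp (ϑ₁ * (pinnedChain ω₂ lam β γ).hamiltonian L x)) :
    D L / ((L : ℝ) - 1) =
      γ * (1 - γ / T ^ 2 * ∫ x, g x * (kin L 0 x - T) ∂((pinnedChain ω₂ lam β γ).gibbsMeasure L T)) := by
  have hL : 0 < L := by omega
  have hL1 : L - 1 < L := by omega
  set P := pinnedChain ω₂ lam β γ with hP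
  set μT := P.gibbsMeasure L T with hμT
  haveI : IsProbabilityMeasure μT := pinnedChain_isProbabilityMeasure_gibbsMeasure hω hl.le hβ.le γ L hT
  set i0 : Fin L := ⟨0, hL⟩ with hi0
  set i1 : Fin L := ⟨L - 1, hL1⟩ with hi1
  set H : PhaseSpace L → ℝ := P.hamiltonian L with hH
  have hHc : Continuous H := pinnedChain_continuous_hamiltonian ω₂ lam β γ L
  have hH0 : ∀ x, 0 ≤ H x := fun x => pinnedChain_hamiltonian_nonneg hω.le hl.le hβ.le γ L x
  -- (1) `g` is smooth and `|g| ≤ M_g e^{H/4T}` everywhere (helper V)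
  have hgs : ContDiff ℝ ((⊤ : ℕ∞) : WithTop ℕ∞) g := forwardField_contDiff hω hl.le hβ hγ hL hT hC hgL2 hmean hpde
  obtain ⟨Mg, hMg0, hgb0⟩ := forwardField_abs_le_exp hω hl.le hβ hγ hL hT hC hgL2 hmean hpde
  have hgc : Continuous g := hC.continuous
  have hgd : Differentiable ℝ g := hC.differentiable (by norm_num)
  have hg3 : ContDiff ℝ 3 g := hgs.of_le (by norm_cast)
  have hd0s : ContDiff ℝ 2 (partialP i0 g) := contDiff_partialP hg3 (by norm_num) i0
  have hd1s : ContDiff ℝ 2 (partialP i1 g) := contDiff_partialP hg3 (by norm_num) i1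
  have hdd0s : ContDiff ℝ 1 (partialP i0 (partialP i0 g)) := contDiff_partialP hd0s (by norm_num) i0
  have hdd1s : ContDiff ℝ 1 (partialP i1 (partialP i1 g)) := contDiff_partialP hd1s (by norm_num) i1
  have hdd0c : Continuous (partialP i0 (partialP i0 g)) := hdd0s.continuous
  have hdd1c : Continuous (partialP i1 (partialP i1 g)) := hdd1s.continuous
  set ϑ₀ : ℝ := 1 / (4 * T) with hϑ₀
  have hϑ₀0 : 0 < ϑ₀ := by positivity
  set k : PhaseSpace L → ℝ := fun y => y.2 i0 ^ 2 - T with hk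
  have hkc : Continuous k := by rw [hk]; fun_prop
  -- (2) one exponent `ϑ⋆ = max ϑ₀ ϑ₁` and one constant for all the bounds
  set ϑs : ℝ := max ϑ₀ ϑ₁ with hϑs
  have hϑs0 : 0 < ϑs := lt_max_of_lt_left hϑ₀0
  have h2ϑs : 2 * ϑs < 1 / T := by
    rcases le_total ϑ₀ ϑ₁ with h | h
    · rw [hϑs, max_eq_right h]; exact h2ϑ₁
    · rw [hϑs, max_eq_left h, hϑ₀, show 2 * (1 / (4 * T)) = 1 / (2 * T) by field_simp; ring,
        div_lt_div_iff₀ (by positivity) hT]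
      nlinarith
  have hmono : ∀ {ϑ : ℝ} (x : PhaseSpace L), ϑ ≤ ϑs → Real.exp (ϑ * H x) ≤ Real.exp (ϑs * H x) :=
    fun x h => Real.exp_le_exp.2 (mul_le_mul_of_nonneg_right h (hH0 x))
  have hC₁ : 0 ≤ C₁ := by
    have h := (hgrad 0).1
    exact nonneg_of_mul_nonneg_left ((abs_nonneg _).trans h) (Real.exp_pos _)
  set Cs : ℝ := Mg + C₁ + (2 / ϑs + T) + γ * T * C₁ with hCs
  have h2ϑ : 0 ≤ 2 / ϑs := by positivity
  have hγTC : 0 ≤ γ * T * C₁ := by positivity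
  have hMgCs : Mg ≤ Cs := by rw [hCs]; linarith
  have hC₁Cs : C₁ ≤ Cs := by rw [hCs]; linarith
  have hKCs : (2 / ϑs + T) + γ * T * C₁ ≤ Cs := by rw [hCs]; linarith
  have hkb : ∀ y, |k y| ≤ (2 / ϑs + T) * Real.exp (ϑs * H y) := fun y =>
    abs_sq_momentum_sub_le_exp hω hl.le hβ.le hϑs0 hT.le y i0
  have hgb : ∀ x, |g x| ≤ Cs * Real.exp (ϑs * H x) := fun x =>
    ((hgb0 x).trans (mul_le_mul_of_nonneg_left (hmono x (le_max_left _ _)) hMg0)).trans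
      (mul_le_mul_of_nonneg_right hMgCs (Real.exp_pos _).le)
  have hgradS : ∀ x, |partialP i0 g x| ≤ C₁ * Real.exp (ϑs * H x) ∧ |partialP i1 g x| ≤ C₁ * Real.exp (ϑs * H x) ∧
      |partialP i0 (partialP i0 g) x| ≤ C₁ * Real.exp (ϑs * H x) ∧
      |partialP i1 (partialP i1 g) x| ≤ C₁ * Real.exp (ϑs * H x) := by
    intro x
    obtain ⟨h1, h2, h3, h4⟩ := hgrad x
    have hm := mul_le_mul_of_nonneg_left (hmono x (le_max_right ϑ₀ ϑ₁)) hC₁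
    exact ⟨h1.trans hm, h2.trans hm, h3.trans hm, h4.trans hm⟩
  have hP0 : ∀ x, |partialP i0 g x| ≤ Cs * Real.exp (ϑs * H x) := fun x =>
    ((hgradS x).1).trans (mul_le_mul_of_nonneg_right hC₁Cs (Real.exp_pos _).le)
  have hP1 : ∀ x, |partialP i1 g x| ≤ Cs * Real.exp (ϑs * H x) := fun x =>
    ((hgradS x).2.1).trans (mul_le_mul_of_nonneg_right hC₁Cs (Real.exp_pos _).le)
  -- (3) the generator at temperatures `T ± δ/2` on `g`, pointwise
  have hPγ : P.γ = γ := rfl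
  have hLδ : ∀ (δ : ℝ) (x : PhaseSpace L), P.generator L (T + δ / 2) (T - δ / 2) g x =
      -k x + γ * (δ / 2 * partialP i0 (partialP i0 g) x + -(δ / 2) * partialP i1 (partialP i1 g) x) := by
    intro δ x
    rw [show T - δ / 2 = T + -(δ / 2) by ring, generator_temp_split P L T (δ / 2) (-(δ / 2)) g x,
      sum_bath_two hL2, hpde x, kin_eq_sq hL, hPγ]
  have hLδb : ∀ δ : ℝ, |δ| < T → ∀ x, |P.generator L (T + δ / 2) (T - δ / 2) g x| ≤ Cs * Real.exp (ϑs * H x) := by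
    intro δ hδ x
    rw [hLδ δ x]
    obtain ⟨-, -, h3, h4⟩ := hgradS x
    set a := partialP i0 (partialP i0 g) x with ha
    set b := partialP i1 (partialP i1 g) x with hb
    set e := Real.exp (ϑs * H x) with he
    have hE : 0 ≤ e := (Real.exp_pos _).le
    have hδ' : |δ| / 2 ≤ T / 2 := by linarith
    have e1 : |-k x + γ * (δ / 2 * a + -(δ / 2) * b)| ≤ |k x| + γ * (|δ| / 2 * |a| + |δ| / 2 * |b|) := by
      calc |-k x + γ * (δ / 2 * a + -(δ / 2) * b)| ≤ |-k x| + |γ * (δ / 2 * a + -(δ / 2) * b)| :=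
            abs_add_le _ _
        _ = |k x| + γ * |δ / 2 * a + -(δ / 2) * b| := by rw [abs_neg, abs_mul, abs_of_pos hγ]
        _ ≤ |k x| + γ * (|δ / 2 * a| + |-(δ / 2) * b|) := by gcongr; exact abs_add_le _ _
        _ = |k x| + γ * (|δ| / 2 * |a| + |δ| / 2 * |b|) := by
            rw [abs_mul, abs_mul, abs_neg, abs_div, abs_two]
    have hA : |δ| / 2 * |a| ≤ T / 2 * (C₁ * e) := mul_le_mul hδ' h3 (abs_nonneg _) (by positivity)
    have hB : |δ| / 2 * |b| ≤ T / 2 * (C₁ * e) := mul_le_mul hδ' h4 (abs_nonneg _) (by positivity)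
    have hsum : |k x| + γ * (|δ| / 2 * |a| + |δ| / 2 * |b|) ≤
        (2 / ϑs + T) * e + γ * (T / 2 * (C₁ * e) + T / 2 * (C₁ * e)) :=
      add_le_add (hkb x) (mul_le_mul_of_nonneg_left (add_le_add hA hB) hγ.le)
    calc |-k x + γ * (δ / 2 * a + -(δ / 2) * b)| ≤ (2 / ϑs + T) * e + γ * (T / 2 * (C₁ * e) + T / 2 * (C₁ * e)) :=
          e1.trans hsum
      _ = ((2 / ϑs + T) + γ * T * C₁) * e := by ring
      _ ≤ Cs * e := mul_le_mul_of_nonneg_right hKCs hE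
  -- (4) the family near `δ = 0` and weak stationarity tested on `g`
  set μf : ℝ → Measure (PhaseSpace L) := fun δ => μ L (T + δ / 2) (T - δ / 2) with hμf
  set ϑ' : ℝ := (ϑs + 2 / (3 * T)) / 2 with hϑ'
  have hϑs23 : ϑs < 2 / (3 * T) := by
    have h1 : ϑs < 1 / (2 * T) := by rw [lt_div_iff₀ (by positivity)]; rw [lt_div_iff₀ hT] at h2ϑs; linarith
    have h2 : 1 / (2 * T) < 2 / (3 * T) := by rw [div_lt_div_iff₀ (by positivity) (by positivity)]; nlinarith
    linarith
  have hϑsϑ' : ϑs < ϑ' := by rw [hϑ']; linarith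
  have hϑ'23 : ϑ' < 2 / (3 * T) := by rw [hϑ']; linarith
  have hmaxinv : ∀ δ : ℝ, |δ| < T → 2 / (3 * T) < 1 / max (T + δ / 2) (T - δ / 2) := by
    intro δ hδ
    have hδ1 := abs_lt.1 hδ
    have hmax : max (T + δ / 2) (T - δ / 2) < 3 * T / 2 := max_lt (by linarith) (by linarith)
    have hmax0 : 0 < max (T + δ / 2) (T - δ / 2) := lt_max_of_lt_left (by linarith)
    rw [div_lt_div_iff₀ (by positivity) hmax0]; nlinarith
  have hstat : ∀ δ : ℝ, |δ| < T → δ ≠ 0 →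
      (∫ y, k y ∂(μf δ)) / δ = γ / 2 * ((∫ x, partialP i0 (partialP i0 g) x ∂(μf δ)) -
        ∫ x, partialP i1 (partialP i1 g) x ∂(μf δ)) := by
    intro δ hδ hδ0
    have hδ1 := abs_lt.1 hδ
    have hTL : 0 < T + δ / 2 := by linarith
    have hTR : 0 < T - δ / 2 := by linarith
    obtain ⟨hprob, -, hexpm, -⟩ :=
      BondHeatUncertainty.ness_facts ω₂ lam β γ hω hl hβ hγ hU μ hμ L hL2 _ _ hTL hTR
    haveI := hprob
    have hϑ'1 : ϑ' < 1 / max (T + δ / 2) (T - δ / 2) := hϑ'23.trans (hmaxinv δ hδ)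
    have hϑ'0 : 0 < ϑ' := hϑs0.trans hϑsϑ'
    have hexp : Integrable (fun x => Real.exp (ϑ' * H x)) (μf δ) := hexpm ϑ' hϑ'0 hϑ'1
    have hweak := (hμ L _ _ hTL hTR).2.1
    have h0 := pinnedChain_integral_generator_eq_zero_of_expGrowth hω hl.le hβ.le hγ.le hL hTL.le hTR.le (μf δ)
      hweak hϑsϑ' hexp hgs hgb (hLδb δ hδ) hP0 hP1
    have hexps : Integrable (fun x => Real.exp (ϑs * H x)) (μf δ) := hexpm ϑs hϑs0 (hϑsϑ'.trans hϑ'1)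
    have hki : Integrable k (μf δ) := integrable_of_abs_le_exp hexps hkc hkb
    have hdd0 : Integrable (partialP i0 (partialP i0 g)) (μf δ) :=
      integrable_of_abs_le_exp hexps hdd0c fun x => (hgradS x).2.2.1
    have hdd1 : Integrable (partialP i1 (partialP i1 g)) (μf δ) :=
      integrable_of_abs_le_exp hexps hdd1c fun x => (hgradS x).2.2.2
    have e1 : (fun x => P.generator L (T + δ / 2) (T - δ / 2) g x) = fun x =>
        (γ * (δ / 2) * partialP i0 (partialP i0 g) x - γ * (δ / 2) * partialP i1 (partialP i1 g) x) - k x := by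
      funext x; rw [hLδ δ x]; ring
    have I1 : Integrable (fun x => γ * (δ / 2) * partialP i0 (partialP i0 g) x) (μf δ) := hdd0.const_mul _
    have I2 : Integrable (fun x => γ * (δ / 2) * partialP i1 (partialP i1 g) x) (μf δ) := hdd1.const_mul _
    have I12 : Integrable (fun x => γ * (δ / 2) * partialP i0 (partialP i0 g) x -
        γ * (δ / 2) * partialP i1 (partialP i1 g) x) (μf δ) := I1.sub I2
    rw [e1, integral_sub I12 hki, integral_sub I1 I2, integral_const_mul, integral_const_mul] at h0
    have hIk : ∫ y, k y ∂(μf δ) = γ * (δ / 2) * (∫ x, partialP i0 (partialP i0 g) x ∂(μf δ)) -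
        γ * (δ / 2) * ∫ x, partialP i1 (partialP i1 g) x ∂(μf δ) := by linarith
    rw [hIk]
    field_simp
  -- (5) weak continuity of the family on `∂²_{p_b} g` and the equilibrium values (Gaussian IBP)
  have hμTT : μ L T T = μT := BondHeatUncertainty.ness_eq_gibbsMeasure hω hl hβ hU μ hμ L hT
  have hϑ₁' : ϑ₁ < 1 / (2 * T) := by rw [lt_div_iff₀ (by positivity)]; rw [lt_div_iff₀ hT] at h2ϑ₁; linarith
  have hlim0 := (LinearResponseFTUR.ness_tendsto_integral_of_growth ω₂ lam β γ hω hl hβ hγ hU μ hμ T hT L hL2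
    _ hdd0c C₁ ϑ₁ hϑ₁.le hϑ₁' fun x => (hgrad x).2.2.1).2
  have hlim1 := (LinearResponseFTUR.ness_tendsto_integral_of_growth ω₂ lam β γ hω hl hβ hγ hU μ hμ T hT L hL2
    _ hdd1c C₁ ϑ₁ hϑ₁.le hϑ₁' fun x => (hgrad x).2.2.2).2
  rw [hμTT] at hlim0 hlim1
  have hexpT : Integrable (fun x => Real.exp (ϑ₁ * H x)) μT :=
    pinnedChain_integrable_exp_mul_hamiltonian_gibbsMeasure hω hl.le hβ.le γ L hT (by linarith)
  have hA0 := pinnedChain_integral_partialP_partialP_gibbsMeasure hω hl.le hβ.le γ L hT i0 hgd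
    (hd0s.differentiable (by norm_num)) hgL2
    (memLp_two_of_abs_le_exp hω hl.le hβ.le γ L hT h2ϑ₁ hd0s.continuous fun x => (hgrad x).1)
    (integrable_of_abs_le_exp hexpT hdd0c fun x => (hgrad x).2.2.1)
  have hB0 := pinnedChain_integral_partialP_partialP_gibbsMeasure hω hl.le hβ.le γ L hT i1 hgd
    (hd1s.differentiable (by norm_num)) hgL2
    (memLp_two_of_abs_le_exp hω hl.le hβ.le γ L hT h2ϑ₁ hd1s.continuous fun x => (hgrad x).2.1)
    (integrable_of_abs_le_exp hexpT hdd1c fun x => (hgrad x).2.2.2)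
  set A : ℝ := ∫ x, g x * (kin L 0 x - T) ∂μT with hA
  set B : ℝ := ∫ x, g x * (kin L (L - 1) x - T) ∂μT with hB
  have hA' : ∫ x, partialP i0 (partialP i0 g) x ∂μT = T⁻¹ ^ 2 * A := by
    rw [hA0, hA]; congr 1
    refine integral_congr_ae (ae_of_all _ fun x => ?_)
    dsimp only
    rw [kin_eq_sq hL]
  have hB' : ∫ x, partialP i1 (partialP i1 g) x ∂μT = T⁻¹ ^ 2 * B := by
    rw [hB0, hB]; congr 1
    refine integral_congr_ae (ae_of_all _ fun x => ?_)
    dsimp only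
    rw [kin_eq_sq hL1]
  rw [hA'] at hlim0
  rw [hB'] at hlim1
  -- (6) the limit of `⟨k_0⟩_δ/δ`
  have hball : ∀ᶠ δ in 𝓝 (0 : ℝ), |δ| < T := by
    have : Metric.ball (0 : ℝ) T ∈ 𝓝 (0 : ℝ) := Metric.ball_mem_nhds 0 hT
    filter_upwards [this] with δ hδ
    simpa [Real.dist_eq] using hδ
  have hlimk : Tendsto (fun δ : ℝ => (∫ y, k y ∂(μf δ)) / δ) (𝓝[≠] 0)
      (𝓝 (γ / 2 * (T⁻¹ ^ 2 * A - T⁻¹ ^ 2 * B))) := by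
    have h := (hlim0.sub hlim1).const_mul (γ / 2)
    refine h.congr' ?_
    filter_upwards [hball.filter_mono nhdsWithin_le_nhds, self_mem_nhdsWithin] with δ hδ hδ0
    rw [Set.mem_compl_iff, Set.mem_singleton_iff] at hδ0
    exact (hstat δ hδ hδ0).symm
  -- (7) energy balance and the response coefficient
  have hbal : ∀ᶠ δ in 𝓝[≠] (0 : ℝ),
      ((L : ℝ) - 1) * γ * (1 / 2 - (∫ y, k y ∂(μf δ)) / δ) = P.totalCurrent (μf δ) / δ := by
    filter_upwards [hball.filter_mono nhdsWithin_le_nhds, self_mem_nhdsWithin] with δ hδ hδ0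
    rw [Set.mem_compl_iff, Set.mem_singleton_iff] at hδ0
    have hδ1 := abs_lt.1 hδ
    have hTL : 0 < T + δ / 2 := by linarith
    have hTR : 0 < T - δ / 2 := by linarith
    obtain ⟨hprob, -, hexpm, -⟩ :=
      BondHeatUncertainty.ness_facts ω₂ lam β γ hω hl hβ hγ hU μ hμ L hL2 _ _ hTL hTR
    haveI := hprob
    have hss : P.IsSteadyState L (T + δ / 2) (T - δ / 2) (μf δ) := hμ L _ _ hTL hTR
    have hflip : P.IsFlipSteadyState L (T + δ / 2) (T - δ / 2) 0 (μf δ) :=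
      (P.isFlipSteadyState_zero_iff L _ _ (μf δ)).2 hss
    have htc := VanishingNoiseBound.totalCurrent_eq_left hω hl.le hβ.le hγ hL hTL.le hTR.le hflip
    have hkint : Integrable k (μf δ) :=
      integrable_of_abs_le_exp (hexpm ϑs hϑs0 (hϑs23.trans (hmaxinv δ hδ))) hkc hkb
    have hp2 : ∫ x, x.2 ⟨0, hL⟩ ^ 2 ∂(μf δ) = (∫ y, k y ∂(μf δ)) + T := by
      have e : (fun x : PhaseSpace L => x.2 ⟨0, hL⟩ ^ 2) = fun x => k x + T := by
        funext x; simp [hk, hi0]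
      rw [e, integral_add hkint (integrable_const T), integral_const, probReal_univ, one_smul]
    rw [htc, hp2]
    field_simp
    ring
  have hlimJ : Tendsto (fun δ : ℝ => P.totalCurrent (μf δ) / δ) (𝓝[≠] 0)
      (𝓝 (((L : ℝ) - 1) * γ * (1 / 2 - γ / 2 * (T⁻¹ ^ 2 * A - T⁻¹ ^ 2 * B)))) :=
    ((hlimk.const_sub (1 / 2)).const_mul (((L : ℝ) - 1) * γ)).congr' hbal
  have hDL : D L = ((L : ℝ) - 1) * γ * (1 / 2 - γ / 2 * (T⁻¹ ^ 2 * A - T⁻¹ ^ 2 * B)) :=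
    tendsto_nhds_unique hD hlimJ
  -- (8) the row sum and the algebra
  have hrow : A + B = T ^ 2 / γ := stub_rowSum ω₂ lam β γ T hω hl hβ hγ hT L hL2 g hC hgL2 hmean hpde
  have hBeq : B = T ^ 2 / γ - A := by linarith
  have hL1r : ((L : ℝ) - 1) ≠ 0 := by
    have : (2 : ℝ) ≤ (L : ℝ) := by exact_mod_cast hL2
    linarith
  have hT0 : T ≠ 0 := hT.ne'
  rw [hDL, hBeq]
  field_simp
  ring

/-- **The Kubo link from the CONTACT-GRADIENT GROWTH BOUND** (stub `stub_kuboLink` of line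
`ForecastSensitivitySketch`, third conditional form, the stub's signature VERBATIM behind one global equilibrium
regularity hypothesis `CG`, NO mixing input): if for all admissible parameters, every `T > 0`, every `L ≥ 2` and
every classical mean-zero `C² ∩ L²(μ_T)` left forward field `g` of the `L`-chain the first and second
`p_b`-derivatives of `g` at the two contacts `b ∈ {0, L−1}` are bounded by `C₁ e^{ϑ₁H}` for some `0 < ϑ₁`,
`2ϑ₁ < 1/T`, then along the crux's unique weak steady-state family `D_L/(L−1) = γ(1 − (γ/T²)⟨g, p_0² − T⟩_{μ_T})`
for every such `g` (`stub_kuboLink_of_contactGradientBoundAt`). -/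
theorem stub_kuboLink_of_contactGradientBound :
    (∀ (ω₂ lam β γ T : ℝ), 0 < ω₂ → 0 < lam → 0 < β → 0 < γ → 0 < T → ∀ (L : ℕ) (hL : 2 ≤ L) (g : PhaseSpace L → ℝ), ContDiff ℝ 2 g → MemLp g 2 ((pinnedChain ω₂ lam β γ).gibbsMeasure L T) → ∫ x, g x ∂((pinnedChain ω₂ lam β γ).gibbsMeasure L T) = 0 → (∀ x, (pinnedChain ω₂ lam β γ).generator L T T g x = -(kin L 0 x - T)) → ∃ C₁ ϑ₁ : ℝ, 0 < ϑ₁ ∧ 2 * ϑ₁ < 1 / T ∧ ∀ x, |partialP (⟨0, by omega⟩ : Fin L) g x| ≤ C₁ * Real.exp (ϑ₁ * (pinnedChain ω₂ lam β γ).hamiltonian L x) ∧ |partialP (⟨L - 1, by omega⟩ : Fin L) g x| ≤ C₁ * Real.exp (ϑ₁ * (pinnedChain ω₂ lam β γ).hamiltonian L x) ∧ |partialP (⟨0, by omega⟩ : Fin L) (partialP (⟨0, by omega⟩ : Fin L) g) x| ≤ C₁ * Real.exp (ϑ₁ * (pinnedChain ω₂ lam β γ).hamiltonian L x) ∧ |partialP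 (⟨L - 1, by omega⟩ : Fin L) (partialP (⟨L - 1, by omega⟩ : Fin L) g) x| ≤ C₁ * Real.exp (ϑ₁ * (pinnedChain ω₂ lam β γ).hamiltonian L x)) → ∀ (ω₂ lam β γ : ℝ) (μ : (N : ℕ) → ℝ → ℝ → Measure (PhaseSpace N)) (T : ℝ) (D : ℕ → ℝ), 0 < ω₂ → 0 < lam → 0 < β → 0 < γ → 0 < T → (∀ (N : ℕ) (T_L T_R : ℝ), 0 < T_L → 0 < T_R → ∀ ρ ρ' : Measure (PhaseSpace N), (pinnedChain ω₂ lam β γ).IsSteadyState N T_L T_R ρ → (pinnedChain ω₂ lam β γ).IsSteadyState N T_L T_R ρ' → ρ = ρ') → (∀ (N : ℕ) (T_L T_R : ℝ), 0 < T_L → 0 < T_R → (pinnedChain ω₂ lam β γ).IsSteadyState N T_L T_R (μ N T_L T_R)) → (∀ N : ℕ, Tendsto (fun δ : ℝ => (pinnedChain ω₂ lam β γ).totalCurrent (μ N (T + δ / 2) (T - δ / 2)) / δ) (𝓝[≠] 0) (𝓝 (D N))) → ∀ L : ℕ, 2 ≤ L → ∀ g : PhaseSpace L → ℝ, ContDiff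 ℝ 2 g → MemLp g 2 ((pinnedChain ω₂ lam β γ).gibbsMeasure L T) → ∫ x, g x ∂((pinnedChain ω₂ lam β γ).gibbsMeasure L T) = 0 → (∀ x, (pinnedChain ω₂ lam β γ).generator L T T g x = -(kin L 0 x - T)) → D L / ((L : ℝ) - 1) = γ * (1 - γ / T ^ 2 * ∫ x, g x * (kin L 0 x - T) ∂((pinnedChain ω₂ lam β γ).gibbsMeasure L T)) := by
  intro hCG ω₂ lam β γ μ T D hω hl hβ hγ hT hU hμ hD L hL2 g hC hgL2 hmean hpde
  obtain ⟨C₁, ϑ₁, hϑ₁, h2ϑ₁, hgrad⟩ := hCG ω₂ lam β γ T hω hl hβ hγ hT L hL2 g hC hgL2 hmean hpde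
  exact stub_kuboLink_of_contactGradientBoundAt μ D hω hl hβ hγ hT hU hμ hL2 (hD L) hC hgL2 hmean hpde hϑ₁ h2ϑ₁
    hgrad

end NESS

end Summit.AtomisticToContinuum.FouriersLaw.Cruxes.ConductanceLowerBound.ForecastSensitivity

end
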